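/-
Copyright (c) 2026 the pub-hodgecm-mathlib formalisation cell (harness21).  Prover seat hodgecm-mathlib-R90-IF-p04 (g2), programme R90-TF, section S9 «InnerForm-13.3.6 (c)»,
default offer (d) under the close protocol of R90-IF-plan (g0) (R90 bus 2026-09-04T22:36:38Z).
-/
import Summits.HodgeConjecture.HodgeConjecture.Theorems.R90S9HeckeEigenLawAtGammaSph          -- ★ p862666 (this seat): `trPrime_twistTest_eq_of_factorised` (the `hER` binder at a level); cone ★ LevelPins (`hsep_gammaSph_of_levelPins`'s pins)
import Summits.HodgeConjecture.HodgeConjecture.Theorems.R90S9GelfandVanishingOffLevel         -- ★ (this seat): `exists_level_forall_smoothTrace_eq_zero_of_not_isSpherical` (the `hgel` payer for deep levels)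
import HarnessLib

/-!
# R90-TF · S9 «InnerForm-13.3.6 (c)» — THE DEEP-LEVEL CERTIFICATE: `hsep` of ★ `sec146_of_parts` at `Γ₀^{sph} = gammaSph X` from the level datum ON THE DEEP LEVELS
# `{S′ ⊇ S₀}`, with the eigen-law `hER` and the six definitional pins DISCHARGED (Rogawski 1990 §14.6 p. 242 «`S′` … containing `S ∪ S₀`»)

Cell `hodgecm-mathlib`, crux H413 (`stmt-HodgeConjecture-24833`, lane `--supports … --as helper`), route of record `HCCMUnconditional` (no route verbs; count-neutral).
Programme R90-TF, section S9 = InnerForm-13.3.6 (c) (base `R90-IF`); seat R90-IF-p04 (g2).  Default offer (d).  Sequel of ★ p862607 `R90S9Sec146LevelPins` (§5 cert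
`hsep_gammaSph_of_levelPins`, `Λ := Level L`, binder `hER` open), ★ p862666 `R90S9HeckeEigenLawAtGammaSph` (`hER` at a level from the factorisation pin + Gelfand off the
level) and ★ `R90S9GelfandVanishingOffLevel` (Gelfand off every level `⊇ l₀`).  THIS FILE runs ★ `hsep_of_levels'` on the DEEP levels `Λ := {l : Level L // l₀ ⊆ l}` — print's
«`S′` a finite set of places containing `S ∪ S₀`» — where `hER` is a THEOREM, so the certificate's binders shrink to the genuinely external leaves.  No definition is re-cut:
every constant of ★ `R90S9InnerFormSec146Levels` is per-level.  THEOREMS ONLY: no `def`, no instance, no notation, no named fact, no `sorry`; namespace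
`Summit.HodgeConjecture.HodgeConjecture.R90.S9.InnerFormSec146`.
HONEST LABEL: HC_CM is proved only modulo the 7 printed citations (2 remaining named inputs: hLiu418 = stmt-HodgeConjecture-24832, h413 = stmt-HodgeConjecture-24833) until rung 0
closes; a certificate over named inputs, helpers ≠ leaves.

## What is here (sorry-free, axioms ⊆ {propext, Classical.choice, Quot.sound})
* **`hsep_gammaSph_of_deepLevelPins`** — conclusion BYTEWISE ★ p862147's `hsep` at the datum (`Γ₀.thm1461 Transfer TransferH → ∀ π′, Γ₀.m′ π′ ≠ 0 → ∃ Π, Γ₀.evpRep π′ Π`).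
  BINDERS (all per level `l : Level L`, so any consumer holding them for all levels — e.g. R90-IF-p06's ★ (δ5) — feeds them unchanged): frame facts `hanis` (anisotropy),
  `hH ∕ hHd` (hermitian, unit determinant); measures `hμ` (Haar), `hμK1` (`μ_v(K_v) = 1`, ★ `IsProductHaar`); the factorisation pin `htrX` (S9-R-TG (c)); the χ-expansion on
  the level tests `hχ𝓕` (S8 ∕ S10, ★ p05 J10); the `G`- ∕ `H`-side twists `tw ∕ twH` with the fundamental lemma `hTw ∕ hTHw` (S3 ∕ S6) and eigen-laws `hEP ∕ hEH` (S7); Langlands'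
  lemma `hsepL` (E1 ∕ S10); and the detector `hcoverR` in COFINAL form («for every `l₀` a level `l ⊇ l₀` grading `π′` with a positive guarded detector and its transfers» — the
  grading half is ★ `exists_gradeRep_eq_some`; transfer existence S3 ∕ S6).  GONE w.r.t. §5 of ★ LevelPins: `hER` (★ `trPrime_twistTest_eq_of_factorised` + ★ Gelfand off `l ⊇ l₀`),
  and as there `hUR hUP hUH h𝓕tw hliftEx hgerm`.

[cite: Rogawski1990, §14.6 (14.6.1) p. 241, p. 242 l. 10–15 (chunk p0236 L6–8); §13.7 p. 206 (chunk p0206 L11–12); §13.3 p. 201] [cite: LabesseLanglands1979, Lemma 6.1]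
[cite: CartierCorvallis1979, §IV.1 Cor. 4.1] [cite: GetzHahn2024, Cor. 5.5.2 p. 106]
-/

set_option autoImplicit false
set_option linter.dupNamespace false  -- the mandated namespace repeats the summit's segment (`HodgeConjecture.HodgeConjecture`)

noncomputable section

open NumberField IsDedekindDomain MeasureTheory
open scoped Matrix MatrixGroups Classical ComplexOrder
open Literature.NumberTheory Literature.NumberTheory.Automorphic Literature.NumberTheory.Automorphic.UnitaryGroup
open Literature.NumberTheory.Rogawski1990
open Summit.HodgeConjecture.HodgeConjecture.Cruxes.H413 Summit.HodgeConjecture.HodgeConjecture.Cruxes.H413.F0P3ClassTokenChoice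
open Summit.HodgeConjecture.HodgeConjecture.Cruxes.H413.F0P3GlobalPacket Summit.HodgeConjecture.HodgeConjecture.Cruxes.H413.F0P3LocalPacketKit
open Summit.HodgeConjecture.HodgeConjecture.Cruxes.H413.F0P3UnrTensorInstance (UnrTensor)

namespace Summit.HodgeConjecture.HodgeConjecture.R90.S9.InnerFormSec146

section Cert

variable (TG TH : Type) (L : Type) [Field L] [NumberField L] [IsCMField L] (ι : L →+* ℂ) (H : Matrix (Fin 3) (Fin 3) L) (T : GL (Fin 3) ℂ)
  (hT : (T : Matrix (Fin 3) (Fin 3) ℂ)ᴴ * H.map ι * (T : Matrix (Fin 3) (Fin 3) ℂ) = Literature.Geometry.ComplexHyperbolic.BallModel.J)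
  (μA : Measure (adelicGroupData (↥(maximalRealSubfield L)) L (IsCMField.complexConj L) 3 H).automorphicQuotient)
  [(adelicGroupData (↥(maximalRealSubfield L)) L (IsCMField.complexConj L) 3 H).IsAutomorphicMeasure μA]
  (μv : ∀ v : HeightOneSpectrum (𝓞 ↥(maximalRealSubfield L)), @Measure ((cmDatum L 3 H).Local v) (borel _))
  (Ξ : OneDimAutRepH L → PacketPrimeFin L H) {H' : Matrix (Fin 3) (Fin 3) L}
  (𝔩 : ∀ v : HeightOneSpectrum (𝓞 ↥(maximalRealSubfield L)), LocalPacketKit L H' v)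
  (X : DatumInputs ((UnitaryGroup.arch (↥(maximalRealSubfield L)) L (IsCMField.complexConj L) 3 H → ℂ) ×
      (∀ v : HeightOneSpectrum (𝓞 ↥(maximalRealSubfield L)), (cmDatum L 3 H).Local v → ℂ)) TG TH L ι H T hT μA Ξ 𝔩)
  (Transfer : (UnitaryGroup.arch (↥(maximalRealSubfield L)) L (IsCMField.complexConj L) 3 H → ℂ) ×
      (∀ v : HeightOneSpectrum (𝓞 ↥(maximalRealSubfield L)), (cmDatum L 3 H).Local v → ℂ) → TG → Prop)
  (TransferH : (UnitaryGroup.arch (↥(maximalRealSubfield L)) L (IsCMField.complexConj L) 3 H → ℂ) ×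
      (∀ v : HeightOneSpectrum (𝓞 ↥(maximalRealSubfield L)), (cmDatum L 3 H).Local v → ℂ) → TH → Prop)
  (tw : ∀ l : Level L, HeckeOff L H l → TG → TG) (twH : ∀ l : Level L, HeckeOff L H l → TH → TH)

/-- **DEEP-LEVEL CERTIFICATE — `hsep` OF ★ `sec146_of_parts` AT `Γ₀^{sph} = gammaSph X`**: ★ `R90.S9.hsep_of_levels'` run on the deep levels `Λ := {l // l₀ ⊆ l}`,
`l₀` = the finite set of non-Gelfand places of `U(H)` (★ `exists_level_forall_smoothTrace_eq_zero_of_not_isSpherical`), with the level datum of ★ `R90S9InnerFormSec146Levels`,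
the six definitional pins of ★ `R90S9Sec146LevelPins`, AND the eigen-law `hER` (★ `trPrime_twistTest_eq_of_factorised`) discharged.  Binders per level, consumable as held;
`hcoverR` in cofinal form. [cite: Rogawski1990, §14.6 (14.6.1) p. 241, p. 242 l. 10–15 (chunk p0236 L6–8); §13.7 p. 206] [cite: LabesseLanglands1979, Lemma 6.1] [cite: CartierCorvallis1979, §IV.1 Cor. 4.1] -/
theorem hsep_gammaSph_of_deepLevelPins
    (hanis : ∀ y : Fin 3 → L, Literature.AlgebraicGeometry.ShimuraVarieties.hermForm (cmConjRingHom L) H y y = 0 → y = 0)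
    (hH : (H.map (cmConjRingHom L))ᵀ = H) (hHd : IsUnit H.det)
    (hμ : ∀ v, letI : MeasurableSpace ((cmDatum L 3 H).Local v) := borel _; (μv v).IsHaarMeasure)
    (hμK1 : ∀ v, μv v (cmLocalIntegralLevel L 3 H v : Set ((cmDatum L 3 H).Local v)) = 1)
    (A : RepPrimeSph L ι H T hT μA → (UnitaryGroup.arch (↥(maximalRealSubfield L)) L (IsCMField.complexConj L) 3 H → ℂ) → ℂ)
    (htrX : ∀ (π' : RepPrimeSph L ι H T hT μA)
        (p : (UnitaryGroup.arch (↥(maximalRealSubfield L)) L (IsCMField.complexConj L) 3 H → ℂ) ×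
          (∀ v : HeightOneSpectrum (𝓞 ↥(maximalRealSubfield L)), (cmDatum L 3 H).Local v → ℂ)),
      X.trPrime π' p = A π' p.1 * ∏ᶠ v, (letI : MeasurableSpace ((cmDatum L 3 H).Local v) := borel _;
        ((tupleOf L ι H T hT μA π').2 v).smoothTrace (μv v) (p.2 v)))
    (hχ𝓕 : ∀ (l : Level L) (f' : (UnitaryGroup.arch (↥(maximalRealSubfield L)) L (IsCMField.complexConj L) 3 H → ℂ) ×
        (∀ v : HeightOneSpectrum (𝓞 ↥(maximalRealSubfield L)), (cmDatum L 3 H).Local v → ℂ)), IsLevelTest L ι H T hT l f' →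
      Summable (fun π' : RepPrimeSph L ι H T hT μA => (mPrimeSph L ι H T hT μA π' : ℂ) * X.trPrime π' f') ∧
        X.traceL f' = ∑' π' : RepPrimeSph L ι H T hT μA, (mPrimeSph L ι H T hT μA π' : ℂ) * X.trPrime π' f')
    (hTw : ∀ (l : Level L) (h : HeckeOff L H l) (f' : (UnitaryGroup.arch (↥(maximalRealSubfield L)) L (IsCMField.complexConj L) 3 H → ℂ) ×
        (∀ v : HeightOneSpectrum (𝓞 ↥(maximalRealSubfield L)), (cmDatum L 3 H).Local v → ℂ)) (f : TG),
      IsLevelTest L ι H T hT l f' → Transfer f' f → Transfer (twistTest L H μv l h f') (tw l h f))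
    (hTHw : ∀ (l : Level L) (h : HeckeOff L H l) (f' : (UnitaryGroup.arch (↥(maximalRealSubfield L)) L (IsCMField.complexConj L) 3 H → ℂ) ×
        (∀ v : HeightOneSpectrum (𝓞 ↥(maximalRealSubfield L)), (cmDatum L 3 H).Local v → ℂ)) (fH : TH),
      IsLevelTest L ι H T hT l f' → TransferH f' fH → TransferH (twistTest L H μv l h f') (twH l h fH))
    (hEP : ∀ (l : Level L) (h : HeckeOff L H l) (f' : (UnitaryGroup.arch (↥(maximalRealSubfield L)) L (IsCMField.complexConj L) 3 H → ℂ) ×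
        (∀ v : HeightOneSpectrum (𝓞 ↥(maximalRealSubfield L)), (cmDatum L 3 H).Local v → ℂ)) (f : TG), IsLevelTest L ι H T hT l f' → Transfer f' f →
      ∀ P : X.G.Packet, X.G.packetTrace X.tr P (tw l h f) =
        ((gradePacket _ TG TH L ι H T hT μA μv Ξ 𝔩 X l P).elim 0 fun e => evOff L H μv l e h) * X.G.packetTrace X.tr P f)
    (hEH : ∀ (l : Level L) (h : HeckeOff L H l) (f' : (UnitaryGroup.arch (↥(maximalRealSubfield L)) L (IsCMField.complexConj L) 3 H → ℂ) ×
        (∀ v : HeightOneSpectrum (𝓞 ↥(maximalRealSubfield L)), (cmDatum L 3 H).Local v → ℂ)) (fH : TH), IsLevelTest L ι H T hT l f' → TransferH f' fH →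
      ∀ ρ : X.G.PacketH, X.trH ρ (twH l h fH) =
        ((gradePacketH _ TG TH L ι H T hT μA μv Ξ 𝔩 X l ρ).elim 0 fun e => evOff L H μv l e h) * X.trH ρ fH)
    (hsepL : ∀ l : Level L, IsCountablyLinIndepOn (EvpSupport L H μv l) (fun _ : HeckeOff L H l => True) (evOff L H μv l))
    (hcoverR : ∀ π' : RepPrimeSph L ι H T hT μA, mPrimeSph L ι H T hT μA π' ≠ 0 → ∀ l₀ : Level L,
      ∃ l : Level L, l₀ ⊆ l ∧ ∃ (e : Evp L H) (f₀ : (UnitaryGroup.arch (↥(maximalRealSubfield L)) L (IsCMField.complexConj L) 3 H → ℂ) ×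
          (∀ v : HeightOneSpectrum (𝓞 ↥(maximalRealSubfield L)), (cmDatum L 3 H).Local v → ℂ)) (f : TG) (fH : TH),
        gradeRep L ι H T hT μA μv l π' = some e ∧ IsLevelTest L ι H T hT l f₀ ∧ Transfer f₀ f ∧ TransferH f₀ fH ∧
          (∀ π : RepPrimeSph L ι H T hT μA, 0 ≤ (mPrimeSph L ι H T hT μA π : ℂ) * X.trPrime π f₀) ∧ (mPrimeSph L ι H T hT μA π' : ℂ) * X.trPrime π' f₀ ≠ 0) :
    (gammaSph _ TG TH L ι H T hT μA Ξ 𝔩 X).thm1461 Transfer TransferH →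
      ∀ π' : (gammaSph _ TG TH L ι H T hT μA Ξ 𝔩 X).Rep', (gammaSph _ TG TH L ι H T hT μA Ξ 𝔩 X).m' π' ≠ 0 →
        ∃ P : (gammaSph _ TG TH L ι H T hT μA Ξ 𝔩 X).G.Packet, (gammaSph _ TG TH L ι H T hT μA Ξ 𝔩 X).evpRep π' P := by
  -- the finite set of non-Gelfand places: off any level containing it, non-spherical admissible classes kill the spherical Hecke algebra
  obtain ⟨l₀, hgel⟩ := exists_level_forall_smoothTrace_eq_zero_of_not_isSpherical L H μv hH hHd
    (fun v => letI : MeasurableSpace ((cmDatum L 3 H).Local v) := borel _;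
      ⟨(hμ v).toIsMulLeftInvariant, inferInstance⟩)
  exact R90.S9.hsep_of_levels' (gammaSph _ TG TH L ι H T hT μA Ξ 𝔩 X) Transfer TransferH
    (Λ := {l : Level L // l₀ ⊆ l})
    (fun l => IsLevelTest L ι H T hT l.1) (fun l => hχ𝓕 l.1) (fun l => evOff L H μv l.1) (fun l => EvpSupport L H μv l.1)
    (fun l => gradeRep L ι H T hT μA μv l.1) (fun l => gradePacket _ TG TH L ι H T hT μA μv Ξ 𝔩 X l.1)
    (fun l => gradePacketH _ TG TH L ι H T hT μA μv Ξ 𝔩 X l.1)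
    (fun l π' e h => gradeRep_mem_evpSupport L ι H T hT μA μv l.1 π' e h)
    (fun l P e h => gradePacket_mem_evpSupport TG TH L ι H T hT μA μv Ξ 𝔩 X l.1 P e h)
    (fun l ρ e h => gradePacketH_mem_evpSupport TG TH L ι H T hT μA μv Ξ 𝔩 X l.1 ρ e h)
    (fun l => twistTest L H μv l.1) (fun l => tw l.1) (fun l => twH l.1)
    (fun l h f' hf' => isLevelTest_twistTest L ι H T hT μv
      (fun v => letI : MeasurableSpace ((cmDatum L 3 H).Local v) := borel _; (hμ v).toIsMulLeftInvariant) l.1 h f' hf')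
    (fun l => hTw l.1) (fun l => hTHw l.1)
    (fun l h f' hf' π' => trPrime_twistTest_eq_of_factorised L ι H T hT μA μv TG TH Ξ 𝔩 X hanis hμ hμK1 A htrX l.1
      (fun v hv c hc => hgel l.1 l.2 v hv c hc) h f' hf' π')
    (fun l => hEP l.1) (fun l => hEH l.1) (fun l => hsepL l.1)
    (fun l ρ e h => exists_gradePacket_of_gradePacketH _ TG TH L ι H T hT μA μv Ξ 𝔩 X l.1 ρ e h)
    (fun π' hm => by
      obtain ⟨l, hl, e, f₀, f, fH, h⟩ := hcoverR π' hm l₀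
      exact ⟨⟨l, hl⟩, e, f₀, f, fH, h⟩)
    (fun l π' P e hP hπ => evpRep_gammaSph_of_grade_eq TG TH L ι H T hT μA μv Ξ 𝔩 X hμ l.1 π' P e hP hπ)

end Cert

end Summit.HodgeConjecture.HodgeConjecture.R90.S9.InnerFormSec146

end
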